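/-
Origin: expansion seat `planner-pub-hodgecm-mc-axioms-1-g14-0`, handover #W2 2026-08-20T15:53:55Z md5 a235c21de23a (PKG 1b8e160f1e0c → a235c21de23a; 377 l.; MECHANICAL (iib-R) rewrite v3.1 of the PKG file as it stands (1 token edits; rules R3x1)) (`HOME/mc/pub-hodgecm-mc-axioms-1-g14/revendor/kit-r55/stage55/HodgeCM/CM/Basic.lean`, md5 a235c21de23a, 377 lines);
landed by the gen-22 packager (p-g22) in gate run 55 REPLACES the earlier landed copy of `HodgeCM/CM/Basic.lean` (seat copy carried the packager Origin header of an earlier run (stripped)).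
-/
/-
Origin: CONSTRUCTION seat `planner-pub-hodgecm-mc-glue-1-g6-0` (unit pub-hodgecm-mc-glue-1-g6, gen 6 of mc-glue-1, node E ASSEMBLER + (W1) root packet), 2026-08-19T15:50Z — revision (W1) of `HodgeCM/CM/Basic.lean` for the RUN-37 `Level`-pair ROOT PACKET (kit `mc/pub-hodgecm-mc-glue-1-g6/t37-mcglue1g6.txt`); base PKG ab6125703c20 (RUN-35 bytes, 232 l.). REPLACE — (W1) ROOT: `structure Level V` becomes the PAIR `(Γ, K)` (K compact open in U(V)(𝔸_f), `U(L⁺) ∩ K = Γ`), `Level.isCongruence` a THEOREM of the same name, the `K`-ORDER `PartialOrder.lift Level.K` + `Level.Γ_mono`, the pair meet `Level.inf` (moved here from `Proofs/LevelDirected`), `Level.ofCongruence` (the one sanctioned `levelOf`); rulings BINDER-TRIAGE §57.2 (Θ-sat-K) END STATE = (W1) and §60 (Θ-sat-≤) ORDER OF RECORD. E binder TEXT unchanged, MODEL-N ±0. Kernel only: 0 `proof-hole`, 0 records, 0 `def … : Prop`, cites nothing new; expected `#print axioms` ⊆ {propext, Classical.choice, Quot.sound}.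
-/
/-
Copyright: pub-hodgecm formalisation cell (harness21, 2026). New file (not vendored).
-/
import Literature.AlgebraicGeometry.Motives.WeilTypeCM
import Summits.HodgeConjecture.HodgeCM.Vendored.Hermitian
import Literature.NumberTheory.Automorphic.UnitaryGroupCongruenceSubgroupLevels
import Mathlib.NumberTheory.NumberField.InfinitePlace.Basic
import Mathlib.FieldTheory.Galois.Basic
import Mathlib.FieldTheory.Normal.Closure
import Mathlib.Order.SymmDiff
import HarnessLib.LibrarySuggestionsDenyList   -- build-lane export guard for the HodgeCM cone (operator infra; see that module's docstring)

/-!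
# CM fields, CM types, rank-four faces, hermitian 3-spaces (real definitions, fully proved)

Typed from:
* (a) `docs/m5/2001-FOLLOWUPS-axisym-hodgecm.md` §B.1 — rfwf v3 (a9f5cf86) Def 1.1 (corners of a
  rank-four face), Lemma 1.2, Thm 1.3; PerL v5 (d912a121) Thm 4.4 (the four types `t¹ … t⁴`).
* (b) `run/shared/lean/archive/2001/summits/hodge/work/typing-check-perL.md` (notation of PerL §1).
* (c) the prior programme's Lean (`HodgeCM.Prior.Types`, `HodgeCM.Prior.AllgGroup`): `IsCMS`,
  `flipP = Φ ∆ {t, ι t}`, face relations `[Φ]+[Φ^{(ππ′)}]−[Φ^{(π)}]−[Φ^{(π′)}]`.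

Everything here is a DEFINITION over Mathlib (`NumberField.IsCMField`, `ComplexEmbedding.conjugate`,
`InfinitePlace.mk`, the vendored `CMType`, `unitaryGroup`, `IsCongruenceSubgroup`, `signatureMatrix`, and — for
`Level` — the vendored finite-adelic unitary group `UnitaryGroup.finAdelic` with its arithmetic levels
`UnitaryGroup.arithmeticLevel`, `UnitaryGroup.levelOf`).
No statement of this file is a stub; the combinatorial LEMMAS about these objects (Lemma 1.2, the
pair-sum identity, Lemma 2.1) are stated in `HodgeCM.StubTree.Combinatorics`.
-/

noncomputable section

open NumberField NumberField.ComplexEmbedding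
open scoped symmDiff Matrix ComplexOrder

namespace HodgeCM

open Literature.AlgebraicGeometry.Motives (CMType)
open Literature.AlgebraicGeometry.ShimuraVarieties

/-! ### Bundled CM number fields -/

/-- A CM number field, bundled with its instances (Mathlib `NumberField.IsCMField`: a totally complex
quadratic extension of its maximal totally real subfield `K⁺`). -/
structure CMField : Type 1 where
  /-- the underlying field -/
  K : Type
  [instField : Field K]
  [instNumberField : NumberField K]
  [instIsCMField : IsCMField K]

attribute [instance] CMField.instField CMField.instNumberField CMField.instIsCMField

/-- (Ported verbatim from the HodgeCMPerL package; no docstring in the source.) -/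
instance : CoeSort CMField Type := ⟨CMField.K⟩

namespace CMField

/-- `g = [K:ℚ]/2`, the dimension of a CM abelian variety with CM by `K`. -/
def halfDegree (K : CMField) : ℕ := Module.finrank ℚ K / 2

end CMField

/-! ### CM types: conjugate type, flip at a place, rank-four faces -/

namespace CMTypeOps

variable {K : Type} [Field K]

/-- Membership form of the CM-type axiom. -/
theorem mem_iff_conjugate_notMem (Φ : CMType K) (φ : K →+* ℂ) : φ ∈ Φ.1 ↔ conjugate φ ∉ Φ.1 :=
  Φ.2 φ

/-- (Ported verbatim from the HodgeCMPerL package; no docstring in the source.) -/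
theorem conjugate_mem_iff_notMem (Φ : CMType K) (φ : K →+* ℂ) : conjugate φ ∈ Φ.1 ↔ φ ∉ Φ.1 := by
  have h := Φ.2 (conjugate φ)
  rw [show conjugate (conjugate φ) = φ from involutive_conjugate K φ] at h
  constructor
  · intro hc hφ
    exact (h.mp hc) hφ
  · intro hφ
    by_contra hc
    exact ((Φ.2 φ).not.mp hφ) (by simpa using hc)

/-- The conjugate CM type `Φ̄ = {φ̄ : φ ∈ Φ}`; as a set it is the complement of `Φ`
(rfwf l.48 `Φ̄ := cΦ`; PerL §1). -/
def bar (Φ : CMType K) : CMType K :=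
  ⟨Φ.1ᶜ, fun φ => by
    simp only [Set.mem_compl_iff, not_not]
    exact (conjugate_mem_iff_notMem Φ φ).symm⟩

/-- (Ported verbatim from the HodgeCMPerL package; no docstring in the source.) -/
@[simp] theorem mem_bar_iff (Φ : CMType K) (φ : K →+* ℂ) : φ ∈ (bar Φ).1 ↔ φ ∉ Φ.1 := Iff.rfl

/-- The orbit `{p, p̄}` of an embedding under complex conjugation = its infinite place, as a set of
embeddings. -/
def placeSet (p : K →+* ℂ) : Set (K →+* ℂ) := {p, conjugate p}

/-- (Ported verbatim from the HodgeCMPerL package; no docstring in the source.) -/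
theorem conjugate_mem_placeSet_iff (p φ : K →+* ℂ) : conjugate φ ∈ placeSet p ↔ φ ∈ placeSet p := by
  simp only [placeSet, Set.mem_insert_iff, Set.mem_singleton_iff]
  constructor
  · rintro (h | h)
    · right; rw [← h, involutive_conjugate K φ]
    · left; exact (involutive_conjugate K).injective h
  · rintro (h | h)
    · right; rw [h]
    · left; rw [h, involutive_conjugate K p]

/-- `Φ^{(π)}`: the CM type `Φ` with its element at the place `π` of `p` replaced by the other one,
i.e. the symmetric difference `Φ ∆ {p, p̄}` (rfwf l.47; `HodgeCM.Prior.AllgGroup.oflip`). -/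
def flip (p : K →+* ℂ) (Φ : CMType K) : CMType K :=
  ⟨Φ.1 ∆ placeSet p, fun φ => by
    have hΦ := mem_iff_conjugate_notMem Φ φ
    have hP := conjugate_mem_placeSet_iff p φ
    simp only [Set.mem_symmDiff]
    tauto⟩

/-- (Ported verbatim from the HodgeCMPerL package; no docstring in the source.) -/
theorem mem_flip_iff (p : K →+* ℂ) (Φ : CMType K) (φ : K →+* ℂ) :
    φ ∈ (flip p Φ).1 ↔ (φ ∈ Φ.1 ∧ φ ∉ placeSet p ∨ φ ∈ placeSet p ∧ φ ∉ Φ.1) := by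
  simp [flip, Set.mem_symmDiff]

end CMTypeOps

open CMTypeOps

/-- A **rank-four face** `(Φ; π, π′)` of a CM field `K` (rfwf Def 1.1): a CM type `Φ` and two DISTINCT
infinite places `π ≠ π′`, given by representatives `p, p′`. -/
structure Face (K : Type) [Field K] where
  /-- the base CM type `Φ = Φ₁` -/
  Φ : CMType K
  /-- a representative of the place `π` -/
  p : K →+* ℂ
  /-- a representative of the place `π′` -/
  p' : K →+* ℂ
  /-- `π ≠ π′` -/
  place_ne : InfinitePlace.mk p ≠ InfinitePlace.mk p'

namespace Face

variable {K : Type} [Field K]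

/-- The four **corners** of the face (rfwf Def 1.1, verbatim): `Φ₁ = Φ`, `Φ₂ = Φ̄^{(π)}`, `Φ₃ = Φ̄^{(π′)}`,
`Φ₄ = Φ^{(ππ′)}`. The product `P = ∏ A_{Φᵢ}` carries the Weil `F`-line `W_F(P)`; `Σᵢ 1_{Φᵢ} = 2`
(Lemma 1.2) makes it of Hodge type `(2,2)`. Indexing: `corner 0 … corner 3` = `Φ₁ … Φ₄`. -/
def corner (f : Face K) : Fin 4 → CMType K
  | 0 => f.Φ
  | 1 => flip f.p (bar f.Φ)
  | 2 => flip f.p' (bar f.Φ)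
  | 3 => flip f.p' (flip f.p f.Φ)

/-- The four **period types** `Ψ₁ … Ψ₄` of the face: the corners of the corresponding face of the
CUBE of types, `Ψ = (Φ, Φ^{(ππ′)}, Φ^{(π)}, Φ^{(π′)})`, i.e. `(Φ₁, Φ₄, Φ̄₂, Φ̄₃)`. These are the types of the
four holomorphic one-forms in the period integral (PerL Thm 4.4: `t¹,t²` unconjugated, `t³,t⁴`
conjugated; rfwf Thm 4.1 / §4.2), they satisfy the pair-sum ("tetrahedron") identity
`1_{Ψ₁} + 1_{Ψ₂} = 1_{Ψ₃} + 1_{Ψ₄}` (PerL rem:tetra; rfwf l:tetra), and `[Ψ₁]+[Ψ₂]−[Ψ₃]−[Ψ₄]` is the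
face relation `r(Φ;π,π′)` of the relation lattice (rfwf l.273–282; `HodgeCM.Prior.AllgGroup.gface`).
TYPING NOTE: the dictionary "corner types (conjugated at 2,3) ↔ period types (conj on one-forms 3,4)"
is this definition; it is the object of rfwf Prop 2.2's eigencharacter bookkeeping. -/
def psi (f : Face K) : Fin 4 → CMType K
  | 0 => f.Φ
  | 1 => flip f.p' (flip f.p f.Φ)
  | 2 => flip f.p f.Φ
  | 3 => flip f.p' f.Φ

/-- An embedding `ι₁` is **admissible** for the face if it lies in all four period types, i.e.
`ι₁ ∈ Φ` and the place of `ι₁` is neither `π` nor `π′` (possible iff `g ≥ 3`: rfwf Lemma 2.1 / the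
hypothesis `2g ≥ 6`). It is the embedding whose eigen-one-forms `α_i` enter the period, and the place
at which the hermitian 3-space has signature `(2,1)`. -/
def Admissible (f : Face K) (ι₁ : K →+* ℂ) : Prop :=
  ι₁ ∈ f.Φ.1 ∧ InfinitePlace.mk ι₁ ≠ InfinitePlace.mk f.p ∧ InfinitePlace.mk ι₁ ≠ InfinitePlace.mk f.p'

end Face

/-! ### The pair-sum identity and CM-type quadruples (PerL rem:tetra, rfwf l:tetra) -/

/-- Indicator of a CM type as an integer-valued function on embeddings. -/
def ind {K : Type} [Field K] (Φ : CMType K) (φ : K →+* ℂ) : ℤ :=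
  by classical exact if φ ∈ Φ.1 then 1 else 0

/-- The **pair-sum (tetrahedron) identity** `1_{Ψ₁} + 1_{Ψ₂} = 1_{Ψ₃} + 1_{Ψ₄}` for a quadruple of CM types
(PerL v5 rem:tetra, tex ll. 210–213; rfwf l:tetra l.86). This — with pairwise distinctness — is ALL that
the transposition audit (rfwf §4.2) says the proof of PerL Thm 4.4 uses of its four types. -/
def PairSum {K : Type} [Field K] (Ψ : Fin 4 → CMType K) : Prop :=
  ∀ φ : K →+* ℂ, ind (Ψ 0) φ + ind (Ψ 1) φ = ind (Ψ 2) φ + ind (Ψ 3) φ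

/-- `Σᵢ 1_{Φᵢ} = 2` pointwise (rfwf Lemma 1.2 for the corners of a face): the Hodge-type-(2,2) condition
for the Weil line of `∏ A_{Φᵢ}`. -/
def SumTwo {K : Type} [Field K] (Φ : Fin 4 → CMType K) : Prop :=
  ∀ φ : K →+* ℂ, ind (Φ 0) φ + ind (Φ 1) φ + ind (Φ 2) φ + ind (Φ 3) φ = 2

/-- The sign table of PerL's four types of the sextic field `K` relative to a frame `φ₁, φ₂, φ₃` of its three
places (PerL §1, verbatim): `t¹ = (+,+,+)`, `t² = (+,−,−)`, `t³ = (+,−,+)`, `t⁴ = (+,+,−)`; `+` at place `j`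
means `φⱼ ∈ Φ_t`, `−` means `φ̄ⱼ ∈ Φ_t`. (`true` = `+`.) -/
def perlSign : Fin 4 → Fin 3 → Bool
  | 0 => ![true, true, true]
  | 1 => ![true, false, false]
  | 2 => ![true, false, true]
  | 3 => ![true, true, false]

/-- `Ψ : Fin 4 → CMType K` **realises PerL's types** `t¹,…,t⁴` for the frame `φ : Fin 3 → (K →+* ℂ)`. -/
def IsPerLTypes {K : Type} [Field K] (φ : Fin 3 → (K →+* ℂ)) (Ψ : Fin 4 → CMType K) : Prop :=
  ∀ i j, (φ j ∈ (Ψ i).1 ↔ perlSign i j = true)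

/-- A **frame** of the sextic CM field `K`: three embeddings at pairwise distinct places (so that
`{φⱼ, φ̄ⱼ}` enumerate `Hom(K, ℂ)`). -/
def IsFrame {K : Type} [Field K] (φ : Fin 3 → (K →+* ℂ)) : Prop :=
  ∀ j j', j ≠ j' → InfinitePlace.mk (φ j) ≠ InfinitePlace.mk (φ j')


/-! ### Hermitian 3-spaces over a CM field and their levels (PerL §1.3; rfwf Thm 4.1; BMM Part 2 §1) -/

open Literature.NumberTheory.Automorphic

/-- A **hermitian 3-space** `(V₃, h)` over the CM field `L` (relative to `L/L₀`), of signature `(2,1)` at the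
place of `ι₁` and `(3,0)` at every other place: Gram matrix `Hm`, hermitian for complex conjugation
`conjRingHomK L`, Sylvester form `Tᴴ Hm^{ι₁} T = diag(1,1,-1)` at `ι₁`, positive definite elsewhere
(typed after the tree's `UnitaryBallUniformisationDatum`, itself after BMM arXiv:1306.1515 Part 2 §1.1). -/
structure HermSpace3 (L : CMField) (ι₁ : L →+* ℂ) where
  /-- the Gram matrix of `h` on `V₃ = L³` -/
  Hm : Matrix (Fin 3) (Fin 3) L
  /-- `h` is hermitian: `conj (Hᵢⱼ) = Hⱼᵢ` -/
  isHermitian : ∀ i j, conjRingHomK L (Hm i j) = Hm j i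
  /-- signature `(2,1)` at `ι₁` -/
  signature_ι₁ : ∃ T : GL (Fin 3) ℂ, (T : Matrix (Fin 3) (Fin 3) ℂ)ᴴ * Hm.map ι₁ * (T : Matrix _ _ ℂ) =
    signatureMatrix 2
  /-- positive definite at every complex embedding off the place of `ι₁` -/
  posDef_of_ne : ∀ τ : L →+* ℂ, InfinitePlace.mk τ ≠ InfinitePlace.mk ι₁ → (Hm.map τ).PosDef

namespace HermSpace3

variable {L : CMField} {ι₁ : L →+* ℂ}

/-- The finite-adelic points `U(V₃,h)(𝔸_{L₀,f}) ≤ GL₃(𝔸_L^∞)` of the unitary group of `h` relative to `L/L₀`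
(`L₀ = L⁺ = maximalRealSubfield L`, conjugation `IsCMField.complexConj L`, whose underlying ring map is
`conjRingHomK L` by definition): the vendored `UnitaryGroup.finAdelic` (Platonov–Rapinchuk 1994 §5.1) at
`(L⁺, L, c̄, 3, Hm)`.  This is the type of the compact open levels `K` of the adelic lift
(`UnitaryBallAdelicLift.adelicHolFormLift`). -/
abbrev adelicFin (V : HermSpace3 L ι₁) : Subgroup (GL (Fin 3) (IsDedekindDomain.FiniteAdeleRing (𝓞 L) L)) :=
  UnitaryGroup.finAdelic (↥(maximalRealSubfield L)) L (IsCMField.complexConj L) 3 V.Hm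

end HermSpace3

/-- The coercion of Mathlib's `IsCMField.complexConj L : L ≃ₐ[L⁺] L` to a ring map IS the package's
`conjRingHomK L` (definitionally; recorded for rewriting between the two spellings of `IsCongruenceSubgroup`). -/
theorem coe_complexConj_eq_conjRingHomK' (L : CMField) :
    ((IsCMField.complexConj L : L ≃ₐ[↥(maximalRealSubfield L)] L) : L →+* L) = conjRingHomK L :=
  RingHom.ext fun _ => rfl

/-- A **level** for `(V₃,h)`: a torsion-free congruence subgroup `Γ ⊂ U(V₃,h)(L₀)` (PerL Thm 4.4:
"a torsion-free congruence subgroup Γ ⊂ G(L₀)"; congruence is load-bearing — Schoen, ERA-MS 21 (2014),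
gives non-congruence compact ball quotients with non-CM Albanese), recorded TOGETHER WITH a compact open
subgroup `K ≤ U(V₃,h)(𝔸_{L₀,f})` cutting it out: `Γ = U(V₃,h)(L₀) ∩ K` (`arithmeticLevel_K`; the arithmetic level
of Platonov–Rapinchuk 1994 §4.1, BMM Introduction §1.1 `Γ = G(ℚ) ∩ K`).  By Getz–Hahn 2024, Exercise 2.17 (p. 51)
with Definition 15.1 (p. 297) — vendored as
`UnitaryGroup.isCongruenceSubgroup_iff_exists_isCompact_isOpen_arithmeticLevel_eq` — a subgroup of `GL₃(L)` is a
congruence subgroup of `U(V₃,h)(L₀)` iff such a `K` exists, so the pairs `(Γ, K)` have exactly the congruence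
subgroups as first components (`Level.isCongruence`, `Level.ofCongruence`); the pair is the datum because the
automorphic side (adelic lift of holomorphic forms, Hecke level, theta saturation) is indexed by `K` and
`K ↦ U(L₀) ∩ K` is not injective.  Levels are ORDERED BY `K` (`Level.le_def`; `Level.Γ_mono` recovers
`Γ' ≤ Γ` in `GL₃(L)`), with meet the pairwise intersection (`Level.inf`). -/
structure Level {L : CMField} {ι₁ : L →+* ℂ} (V : HermSpace3 L ι₁) where
  /-- the arithmetic group, inside `GL₃(L)` -/
  Γ : Subgroup (GL (Fin 3) L)
  /-- the compact open level `K ≤ U(V₃,h)(𝔸_{L₀,f})` -/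
  K : Subgroup V.adelicFin
  /-- `K` is compact -/
  isCompact_K : IsCompact (K : Set V.adelicFin)
  /-- `K` is open -/
  isOpen_K : IsOpen (K : Set V.adelicFin)
  /-- `Γ = U(V₃,h)(L₀) ∩ K` -/
  arithmeticLevel_K :
    UnitaryGroup.arithmeticLevel (↥(maximalRealSubfield L)) L (IsCMField.complexConj L) 3 V.Hm K = Γ
  /-- `Γ` is torsion free -/
  torsionFree : ∀ γ ∈ Γ, IsOfFinOrder γ → γ = 1

namespace Level

variable {L : CMField} {ι₁ : L →+* ℂ} {V : HermSpace3 L ι₁}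

/-- `Γ` is a congruence subgroup of `U(V₃,h)(L₀)`: it is cut out by the compact open `K`
(Getz–Hahn 2024 Exercise 2.17, direction `⇐`: vendored `UnitaryGroup.isCongruenceSubgroup_arithmeticLevel_of_isOpen`).
Same name and type as the former structure field, so every `Γ.isCongruence` of the package is unchanged. -/
theorem isCongruence (Γ : Level V) : IsCongruenceSubgroup (conjRingHomK L) V.Hm Γ.Γ :=
  Γ.arithmeticLevel_K ▸ UnitaryGroup.isCongruenceSubgroup_arithmeticLevel_of_isOpen Γ.isCompact_K Γ.isOpen_K

/-- `Level.isCongruence` with the conjugation spelled as the coercion of `IsCMField.complexConj L` (the currency of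
the vendored `UnitaryGroup` files; definitionally the same statement). -/
theorem isCongruence_coe (Γ : Level V) :
    IsCongruenceSubgroup ((IsCMField.complexConj L : L ≃ₐ[↥(maximalRealSubfield L)] L) : L →+* L) V.Hm Γ.Γ :=
  Γ.isCongruence

/-- `Γ ≤ U(V₃,h)(L₀)`. -/
theorem Γ_le_rational (Γ : Level V) :
    Γ.Γ ≤ UnitaryGroup.rational (↥(maximalRealSubfield L)) L (IsCMField.complexConj L) 3 V.Hm :=
  Γ.arithmeticLevel_K ▸ UnitaryGroup.arithmeticLevel_le_rational Γ.K

/-- A level is determined by its compact open `K` (`Γ = U(L₀) ∩ K`). -/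
theorem K_injective : Function.Injective (Level.K : Level V → Subgroup V.adelicFin) := by
  rintro ⟨Γ₁, K₁, _, _, h₁, _⟩ ⟨Γ₂, K₂, _, _, h₂, _⟩ (rfl : K₁ = K₂)
  obtain rfl : Γ₁ = Γ₂ := h₁.symm.trans h₂
  rfl

/-- (Ported verbatim from the HodgeCMPerL package; no docstring in the source.) -/
@[ext] theorem ext {Γ₁ Γ₂ : Level V} (h : Γ₁.K = Γ₂.K) : Γ₁ = Γ₂ := K_injective h

/-- **The order of record on levels: inclusion of the compact opens `K`.** -/
instance instPartialOrder : PartialOrder (Level V) := PartialOrder.lift Level.K Level.K_injective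

/-- (Ported verbatim from the HodgeCMPerL package; no docstring in the source.) -/
theorem le_def {Γ' Γ : Level V} : Γ' ≤ Γ ↔ Γ'.K ≤ Γ.K := Iff.rfl

/-- `K' ≤ K` gives `Γ' ≤ Γ` in `GL₃(L)` (`cover` functoriality of arithmetic levels,
vendored `UnitaryGroup.arithmeticLevel_mono`). -/
theorem Γ_mono {Γ' Γ : Level V} (h : Γ' ≤ Γ) : Γ'.Γ ≤ Γ.Γ := by
  have h' := UnitaryGroup.arithmeticLevel_mono
    (F := ↥(maximalRealSubfield L)) (E := L) (c := IsCMField.complexConj L) (N := 3) (J := V.Hm) (le_def.mp h)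
  rwa [Γ'.arithmeticLevel_K, Γ.arithmeticLevel_K] at h'

/-- **The meet of two levels**: the pair `(Γ₁ ∩ Γ₂, K₁ ∩ K₂)` (an intersection of compact opens is compact open, and
`U(L₀) ∩ (K₁ ∩ K₂) = (U(L₀) ∩ K₁) ∩ (U(L₀) ∩ K₂)`, vendored `UnitaryGroup.arithmeticLevel_inf`). -/
protected def inf (Γ₁ Γ₂ : Level V) : Level V where
  Γ := Γ₁.Γ ⊓ Γ₂.Γ
  K := Γ₁.K ⊓ Γ₂.K
  isCompact_K := Γ₁.isCompact_K.inter_right (Γ₂.K.isClosed_of_isOpen Γ₂.isOpen_K)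
  isOpen_K := Γ₁.isOpen_K.inter Γ₂.isOpen_K
  arithmeticLevel_K := by rw [UnitaryGroup.arithmeticLevel_inf, Γ₁.arithmeticLevel_K, Γ₂.arithmeticLevel_K]
  torsionFree γ hγ hfin := Γ₁.torsionFree γ (Subgroup.mem_inf.mp hγ).1 hfin

/-- Levels form a meet-semilattice for the `K`-order. -/
instance instSemilatticeInf : SemilatticeInf (Level V) where
  __ := (inferInstance : PartialOrder (Level V))
  inf := Level.inf
  inf_le_left Γ₁ Γ₂ := (inf_le_left : Γ₁.K ⊓ Γ₂.K ≤ Γ₁.K)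
  inf_le_right Γ₁ Γ₂ := (inf_le_right : Γ₁.K ⊓ Γ₂.K ≤ Γ₂.K)
  le_inf Γ₁ Γ₂ Γ₃ h₁ h₂ := (le_inf h₁ h₂ : Γ₁.K ≤ Γ₂.K ⊓ Γ₃.K)

/-- (Ported verbatim from the HodgeCMPerL package; no docstring in the source.) -/
theorem inf_def (Γ₁ Γ₂ : Level V) : Γ₁ ⊓ Γ₂ = Γ₁.inf Γ₂ := rfl

/-- (Ported verbatim from the HodgeCMPerL package; no docstring in the source.) -/
@[simp] theorem inf_K (Γ₁ Γ₂ : Level V) : (Γ₁ ⊓ Γ₂).K = Γ₁.K ⊓ Γ₂.K := rfl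

/-- (Ported verbatim from the HodgeCMPerL package; no docstring in the source.) -/
@[simp] theorem inf_Γ (Γ₁ Γ₂ : Level V) : (Γ₁ ⊓ Γ₂).Γ = Γ₁.Γ ⊓ Γ₂.Γ := rfl

/-- **Levels are directed** (for the `K`-order, hence — `Γ_mono` — in `GL₃(L)`): any two levels have a common
refinement, their meet. -/
theorem exists_le_le (Γ Γ₀ : Level V) : ∃ Γ₁ : Level V, Γ₁ ≤ Γ ∧ Γ₁ ≤ Γ₀ :=
  ⟨Γ ⊓ Γ₀, inf_le_left, inf_le_right⟩

/-- **The level of a torsion-free congruence subgroup**, paired with its canonical compact open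
`K_Γ := UnitaryGroup.levelOf` (the saturation of the principal level `K_f(n_Γ)` by `Γ`; Getz–Hahn 2024
Exercise 2.17, direction `⇒`), which satisfies `U(L₀) ∩ K_Γ = Γ` (vendored `UnitaryGroup.arithmeticLevel_levelOf`).
This is the ONE place of the package where `levelOf` chooses the compact open; every level produced from another
level (meets, conjugates, deeper principal levels) is born as a pair. -/
def ofCongruence (Γ : Subgroup (GL (Fin 3) L)) (hc : IsCongruenceSubgroup (conjRingHomK L) V.Hm Γ)
    (htf : ∀ γ ∈ Γ, IsOfFinOrder γ → γ = 1) : Level V :=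
  haveI hc' : IsCongruenceSubgroup ((IsCMField.complexConj L : L ≃ₐ[↥(maximalRealSubfield L)] L) : L →+* L)
      V.Hm Γ := hc
  { Γ := Γ
    K := UnitaryGroup.levelOf hc'
    isCompact_K := UnitaryGroup.isCompact_levelOf hc'
    isOpen_K := UnitaryGroup.isOpen_levelOf hc'
    arithmeticLevel_K := UnitaryGroup.arithmeticLevel_levelOf hc'
    torsionFree := htf }

/-- (Ported verbatim from the HodgeCMPerL package; no docstring in the source.) -/
@[simp] theorem Γ_ofCongruence (Γ : Subgroup (GL (Fin 3) L)) (hc : IsCongruenceSubgroup (conjRingHomK L) V.Hm Γ)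
    (htf : ∀ γ ∈ Γ, IsOfFinOrder γ → γ = 1) : (ofCongruence Γ hc htf).Γ = Γ := rfl

/-- (Ported verbatim from the HodgeCMPerL package; no docstring in the source.) -/
theorem K_ofCongruence (Γ : Subgroup (GL (Fin 3) L)) (hc : IsCongruenceSubgroup (conjRingHomK L) V.Hm Γ)
    (htf : ∀ γ ∈ Γ, IsOfFinOrder γ → γ = 1) :
    (ofCongruence Γ hc htf).K = UnitaryGroup.levelOf (Γ := Γ)
      (c := IsCMField.complexConj L) (J := V.Hm) (hc : _) := rfl

end Level

end HodgeCM

end
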